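import Summits.NavierStokesRegularity.FunctionalMining.VorticityL4SaturatingLaw
import Summits.NavierStokesRegularity.FunctionalMining.VelocityL6Interpolation

/-!
# FunctionalMining — K0 row `E.q=6|T_LD|G1`, step 1: the static production bound for `Z₆ = ∫|ω|⁶`

Search for candidate a priori estimates; no regularity claim.

The no-go seat's Theorem G (SIEVELD §3.2) books the rows `E.q|T_LD|G1` as HOLDS ∃κ on paper:
`d/dt Z_q ≤ κ ν^{−γ} (2ℰ) Z_q^{1+1/σ}`, `σ = 2q−3`, `γ = (3q−3)/(2q−3)`. After `q = 4`
(`VorticityL4SaturatingLaw`) this file and its sequel prove the row `q = 6` (`σ = 9`, `γ = 5/3`) as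
a theorem on `T³ = UnitAddTorus (Fin 3)`. Here: the static bound on the production `X = ∫|ω|⁴σ` of
the exact `Z₆` balance (`hasDerivWithinAt_integral_torusVorticitySqAt_pow`, `m = 3`), by
Cauchy–Schwarz only. With `ω = curl v` (smooth, zero-mean), `A_n = ∫‖ω‖ⁿ`, `Z = A₂`,
`I = ∫‖ω‖⁴∑ₖ‖∂ₖω‖²`, `g = ∑ₖ‖∂ₖv‖²`, `J = ∫|ω|²g²`, `G₄ = ∫g⁴`:
`X² ≤ 2A₈J` (pointwise `σ² ≤ 2|ω|²g²`, `VorticityL4.stretchingDensity_sq_le`), `J² ≤ A₄G₄`,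
`G₄ ≤ K A₈` (Calderón–Zygmund at `s = 8`, `VorticityL4CZ`), the Cauchy–Schwarz interpolations
`A₄² ≤ ZA₆`, `A₈² ≤ A₆A₁₀`, `A₁₀³ ≤ A₆²A₁₈`, `A₆² ≤ ZA₁₀`, `A₁₀² ≤ ZA₁₈`, and `A₁₈ ≤ C I³`
(`VelocityL6.integral_norm_pow_eighteen_le`, the explicit nonlinear Poincaré inequality at `a = 2`
applied to `ω`). Hence `X²⁴ ≤ 4096 K⁶ C⁵ · A₆¹⁰ Z⁹ I¹⁵` — the exponents at which Young with the
weights `(15/24, 9/24) = (5/8, 3/8)` absorbs `I¹⁵` into the viscous term `−6νI` (sequel).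

## Main statements

* `stretching6_integral_sq_le` — `(∫|ω|⁴σ)² ≤ 2 (∫|ω|⁸) ∫|ω|²g²`.
* `production6_pow_24_le` — the exponent bookkeeping in polynomial form.
* `production6_bound` — `|∫|ω|⁴σ|²⁴ ≤ 4096 K⁶ C₁₈⁵ (∫‖ω‖⁶)¹⁰ (∫‖ω‖²)⁹ (∫‖ω‖⁴∑ₖ‖∂ₖω‖²)¹⁵` on `T³`.
-/

noncomputable section

open MeasureTheory Finset Set
open scoped InnerProductSpace RealInnerProductSpace ContDiff

namespace Summit.NavierStokesRegularity.FunctionalMining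

open Literature.Analysis.FunctionSpaces Literature.Analysis.FunctionSpaces.Torus
  Literature.Analysis.FluidPDE

namespace VorticityL6

open VorticityL4

variable {d : Type*} [Fintype d] [DecidableEq d]

/-! ## 1. Cauchy–Schwarz for the production of `∫|ω|⁶` -/

/-- **`(∫|ω|⁴σ)² ≤ 2 (∫|ω|⁸) ∫|ω|² (∑ₖ‖∂ₖv‖²)²`** for smooth `v` on `T^d`: Cauchy–Schwarz with the
factors `|ω|⁴` and `σ`, then the pointwise bound `σ² ≤ 2|ω|²(∑ₖ‖∂ₖv‖²)²`
(`VorticityL4.stretchingDensity_sq_le`). [ours] -/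
theorem stretching6_integral_sq_le {v : UnitAddTorus d → EuclideanSpace ℝ d} (hv : IsSmooth v) :
    (∫ x, torusVorticitySqAt v x ^ 2 * torusStretchingDensity v x) ^ 2 ≤
      2 * (∫ x, torusVorticitySqAt v x ^ 4) *
        ∫ x, torusVorticitySqAt v x * (∑ k, ‖partialDeriv k v x‖ ^ 2) ^ 2 := by
  have hω := continuous_vorticitySqAt hv
  have hσ := continuous_stretchingDensity hv
  have hg := continuous_gradSq hv
  have h1 := sq_integral_mul_le (f := fun x => torusVorticitySqAt v x ^ 2)
    (g := torusStretchingDensity v) (hω.pow 2) hσ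
  have e1 : ∫ x, (torusVorticitySqAt v x ^ 2) ^ 2 = ∫ x, torusVorticitySqAt v x ^ 4 :=
    integral_congr_ae (ae_of_all _ fun x => by ring)
  rw [e1] at h1
  have h2 : ∫ x, torusStretchingDensity v x ^ 2 ≤
      ∫ x, 2 * torusVorticitySqAt v x * (∑ k, ‖partialDeriv k v x‖ ^ 2) ^ 2 := by
    refine integral_mono_of_nonneg (ae_of_all _ fun x => sq_nonneg _) ?_
      (ae_of_all _ fun x => stretchingDensity_sq_le v x)
    exact ((continuous_const.mul hω).mul (hg.pow 2)).integrable_of_hasCompactSupport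
      (HasCompactSupport.of_compactSpace _)
  have h3 : ∫ x, 2 * torusVorticitySqAt v x * (∑ k, ‖partialDeriv k v x‖ ^ 2) ^ 2 =
      2 * ∫ x, torusVorticitySqAt v x * (∑ k, ‖partialDeriv k v x‖ ^ 2) ^ 2 := by
    rw [← integral_const_mul]
    exact integral_congr_ae (ae_of_all _ fun x => by ring)
  have hA : 0 ≤ ∫ x, torusVorticitySqAt v x ^ 4 :=
    integral_nonneg fun x => pow_nonneg (torusVorticitySqAt_nonneg v x) 4
  calc (∫ x, torusVorticitySqAt v x ^ 2 * torusStretchingDensity v x) ^ 2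
      ≤ (∫ x, torusVorticitySqAt v x ^ 4) * ∫ x, torusStretchingDensity v x ^ 2 := h1
    _ ≤ (∫ x, torusVorticitySqAt v x ^ 4) *
        (2 * ∫ x, torusVorticitySqAt v x * (∑ k, ‖partialDeriv k v x‖ ^ 2) ^ 2) := by
        rw [← h3]; exact mul_le_mul_of_nonneg_left h2 hA
    _ = _ := by ring

/-- On `T³`, `(|ω|²)ⁿ = ‖curl v‖²ⁿ`. [folklore] -/
theorem vorticitySqAt_pow_eq (v : UnitAddTorus (Fin 3) → EuclideanSpace ℝ (Fin 3))
    (x : UnitAddTorus (Fin 3)) (n : ℕ) :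
    torusVorticitySqAt v x ^ n = ‖BDSV.curl v x‖ ^ (2 * n) := by
  rw [← norm_curl_sq, pow_mul]

/-! ## 2. Real arithmetic: the exponent bookkeeping for `q = 6` -/

omit [Fintype d] [DecidableEq d] in
/-- **Exponent bookkeeping (`q = 6`).** From `X² ≤ 2A₈J`, `J² ≤ A₄G`, `G ≤ c₁A₈`, `A₄² ≤ ZA₆`,
`A₈² ≤ A₆A₁₀`, `A₁₀³ ≤ A₆²A₁₈`, `A₆² ≤ ZA₁₀`, `A₁₀² ≤ ZA₁₈`, `A₁₈ ≤ c₂I³` (all quantities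
non-negative): `X²⁴ ≤ 4096 c₁⁶ c₂⁵ · A₆¹⁰ Z⁹ I¹⁵`
(`X⁴ ≤ 4c₁A₄A₈³`, `A₄⁶ ≤ Z³A₆³`, `A₈¹⁸ ≤ A₆¹⁵A₁₈³`, `A₆⁸ ≤ Z⁶A₁₈²`). [ours; elementary] -/
theorem production6_pow_24_le {X A₄ A₆ A₈ A₁₀ A₁₈ J G Z I c₁ c₂ : ℝ} (hA₄ : 0 ≤ A₄)
    (hA₆ : 0 ≤ A₆) (hA₁₀ : 0 ≤ A₁₀) (hA₁₈ : 0 ≤ A₁₈) (hZ : 0 ≤ Z)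
    (h1 : X ^ 2 ≤ 2 * A₈ * J) (h2 : J ^ 2 ≤ A₄ * G) (h3 : G ≤ c₁ * A₈) (h4 : A₄ ^ 2 ≤ Z * A₆)
    (h5 : A₈ ^ 2 ≤ A₆ * A₁₀) (h6 : A₁₀ ^ 3 ≤ A₆ ^ 2 * A₁₈) (h7 : A₆ ^ 2 ≤ Z * A₁₀)
    (h8 : A₁₀ ^ 2 ≤ Z * A₁₈) (h9 : A₁₈ ≤ c₂ * I ^ 3) :
    X ^ 24 ≤ 4096 * c₁ ^ 6 * c₂ ^ 5 * A₆ ^ 10 * Z ^ 9 * I ^ 15 := by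
  -- `X⁴ ≤ 4 c₁ A₄ A₈³`
  have hX4 : X ^ 4 ≤ 4 * c₁ * A₄ * A₈ ^ 3 := by
    have s1 : (X ^ 2) ^ 2 ≤ (2 * A₈ * J) ^ 2 := pow_le_pow_left₀ (sq_nonneg X) h1 2
    calc X ^ 4 = (X ^ 2) ^ 2 := by ring
      _ ≤ (2 * A₈ * J) ^ 2 := s1
      _ = 4 * A₈ ^ 2 * J ^ 2 := by ring
      _ ≤ 4 * A₈ ^ 2 * (A₄ * G) := by gcongr
      _ ≤ 4 * A₈ ^ 2 * (A₄ * (c₁ * A₈)) := by gcongr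
      _ = 4 * c₁ * A₄ * A₈ ^ 3 := by ring
  -- `A₄⁶ ≤ Z³ A₆³`, `A₈¹⁸ ≤ A₆¹⁵ A₁₈³`, `A₆⁸ ≤ Z⁶ A₁₈²`
  have hA4 : A₄ ^ 6 ≤ Z ^ 3 * A₆ ^ 3 := by
    calc A₄ ^ 6 = (A₄ ^ 2) ^ 3 := by ring
      _ ≤ (Z * A₆) ^ 3 := pow_le_pow_left₀ (sq_nonneg _) h4 3
      _ = Z ^ 3 * A₆ ^ 3 := by ring
  have hA8 : A₈ ^ 18 ≤ A₆ ^ 15 * A₁₈ ^ 3 := by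
    calc A₈ ^ 18 = (A₈ ^ 2) ^ 9 := by ring
      _ ≤ (A₆ * A₁₀) ^ 9 := pow_le_pow_left₀ (sq_nonneg _) h5 9
      _ = A₆ ^ 9 * (A₁₀ ^ 3) ^ 3 := by ring
      _ ≤ A₆ ^ 9 * (A₆ ^ 2 * A₁₈) ^ 3 := by gcongr
      _ = A₆ ^ 15 * A₁₈ ^ 3 := by ring
  have hA6 : A₆ ^ 8 ≤ Z ^ 6 * A₁₈ ^ 2 := by
    calc A₆ ^ 8 = (A₆ ^ 2) ^ 4 := by ring
      _ ≤ (Z * A₁₀) ^ 4 := pow_le_pow_left₀ (sq_nonneg _) h7 4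
      _ = Z ^ 4 * (A₁₀ ^ 2) ^ 2 := by ring
      _ ≤ Z ^ 4 * (Z * A₁₈) ^ 2 := by gcongr
      _ = Z ^ 6 * A₁₈ ^ 2 := by ring
  have hX0 : 0 ≤ X ^ 4 := by positivity
  calc X ^ 24 = (X ^ 4) ^ 6 := by ring
    _ ≤ (4 * c₁ * A₄ * A₈ ^ 3) ^ 6 := pow_le_pow_left₀ hX0 hX4 6
    _ = 4096 * c₁ ^ 6 * A₄ ^ 6 * A₈ ^ 18 := by ring
    _ ≤ 4096 * c₁ ^ 6 * (Z ^ 3 * A₆ ^ 3) * (A₆ ^ 15 * A₁₈ ^ 3) := by gcongr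
    _ = 4096 * c₁ ^ 6 * Z ^ 3 * A₆ ^ 10 * A₁₈ ^ 3 * A₆ ^ 8 := by ring
    _ ≤ 4096 * c₁ ^ 6 * Z ^ 3 * A₆ ^ 10 * A₁₈ ^ 3 * (Z ^ 6 * A₁₈ ^ 2) := by gcongr
    _ = 4096 * c₁ ^ 6 * Z ^ 9 * A₆ ^ 10 * A₁₈ ^ 5 := by ring
    _ ≤ 4096 * c₁ ^ 6 * Z ^ 9 * A₆ ^ 10 * (c₂ * I ^ 3) ^ 5 := by gcongr
    _ = 4096 * c₁ ^ 6 * c₂ ^ 5 * A₆ ^ 10 * Z ^ 9 * I ^ 15 := by ring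

/-! ## 3. The static production bound on `T³` -/

/-- **Production bound (static, `T³`).** With the tree's constants `C₆` (mean-zero Sobolev) and
`K` (Calderón–Zygmund at `s = 8`): for every smooth divergence-free `v` on `T³`, with `ω = curl v`,
`|∫|ω|⁴σ|²⁴ ≤ 4096 K⁶ C₁₈⁵ · (∫‖ω‖⁶)¹⁰ (∫‖ω‖²)⁹ (∫‖ω‖⁴∑ₖ‖∂ₖω‖²)¹⁵`,
`C₁₈ = 32(729C₆ + (39420·27)³)`. [ours] -/
theorem production6_bound {C₆ K : ℝ} (hC₆0 : 0 ≤ C₆)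
    (hC₆ : ∀ w : UnitAddTorus (Fin 3) → EuclideanSpace ℝ (Fin 3), IsSmooth w → HasZeroMean w →
      ∫ x, ‖w x‖ ^ 6 ≤ C₆ * gradNormSq w ^ 3)
    (hK : ∀ w : UnitAddTorus (Fin 3) → EuclideanSpace ℝ (Fin 3), IsSmooth w → IsDivFree w →
      ∫ x, (∑ k, ‖partialDeriv k w x‖ ^ 2) ^ 4 ≤ K * ∫ x, ‖BDSV.curl w x‖ ^ 8)
    {v : UnitAddTorus (Fin 3) → EuclideanSpace ℝ (Fin 3)} (hv : IsSmooth v) (hdiv : IsDivFree v) :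
    |∫ x, torusVorticitySqAt v x ^ 2 * torusStretchingDensity v x| ^ 24 ≤
      4096 * K ^ 6 * (32 * (729 * C₆ + (39420 * (3 : ℝ) ^ 3) ^ 3)) ^ 5 *
        (∫ x, ‖BDSV.curl v x‖ ^ 6) ^ 10 * (∫ x, ‖BDSV.curl v x‖ ^ 2) ^ 9 *
          (∫ x, ‖BDSV.curl v x‖ ^ 4 * ∑ k, ‖partialDeriv k (BDSV.curl v) x‖ ^ 2) ^ 15 := by
  have hω : IsSmooth (BDSV.curl v) := BDSV.isSmooth_curl hv
  have hωc : Continuous (BDSV.curl v) := hω.continuous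
  have h0 : HasZeroMean (BDSV.curl v) := hasZeroMean_curl hv
  -- the quantities
  obtain ⟨X, hX⟩ : ∃ X : ℝ, X = ∫ x, torusVorticitySqAt v x ^ 2 * torusStretchingDensity v x :=
    ⟨_, rfl⟩
  obtain ⟨J, hJ⟩ : ∃ J : ℝ, J = ∫ x, torusVorticitySqAt v x * (∑ k, ‖partialDeriv k v x‖ ^ 2) ^ 2 :=
    ⟨_, rfl⟩
  obtain ⟨G, hG⟩ : ∃ G : ℝ, G = ∫ x, (∑ k, ‖partialDeriv k v x‖ ^ 2) ^ 4 := ⟨_, rfl⟩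
  obtain ⟨Z, hZ⟩ : ∃ Z : ℝ, Z = ∫ x, ‖BDSV.curl v x‖ ^ 2 := ⟨_, rfl⟩
  obtain ⟨A₄, hA₄⟩ : ∃ A : ℝ, A = ∫ x, ‖BDSV.curl v x‖ ^ 4 := ⟨_, rfl⟩
  obtain ⟨A₆, hA₆⟩ : ∃ A : ℝ, A = ∫ x, ‖BDSV.curl v x‖ ^ 6 := ⟨_, rfl⟩
  obtain ⟨A₈, hA₈⟩ : ∃ A : ℝ, A = ∫ x, ‖BDSV.curl v x‖ ^ 8 := ⟨_, rfl⟩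
  obtain ⟨A₁₀, hA₁₀⟩ : ∃ A : ℝ, A = ∫ x, ‖BDSV.curl v x‖ ^ 10 := ⟨_, rfl⟩
  obtain ⟨A₁₈, hA₁₈⟩ : ∃ A : ℝ, A = ∫ x, ‖BDSV.curl v x‖ ^ 18 := ⟨_, rfl⟩
  obtain ⟨I, hI⟩ : ∃ I : ℝ, I = ∫ x, ‖BDSV.curl v x‖ ^ 4 *
      ∑ k, ‖partialDeriv k (BDSV.curl v) x‖ ^ 2 := ⟨_, rfl⟩
  -- `∫ (|ω|²)ⁿ = A_{2n}` in the `torusVorticitySqAt` spelling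
  have hA₄' : ∫ x, torusVorticitySqAt v x ^ 2 = A₄ := by
    rw [hA₄]; exact integral_congr_ae (ae_of_all _ fun x => vorticitySqAt_pow_eq v x 2)
  have hA₈' : ∫ x, torusVorticitySqAt v x ^ 4 = A₈ := by
    rw [hA₈]; exact integral_congr_ae (ae_of_all _ fun x => vorticitySqAt_pow_eq v x 4)
  have hA₄0 : 0 ≤ A₄ := by rw [hA₄]; exact integral_nonneg fun x => by positivity
  have hA₆0 : 0 ≤ A₆ := by rw [hA₆]; exact integral_nonneg fun x => by positivity
  have hA₁₀0 : 0 ≤ A₁₀ := by rw [hA₁₀]; exact integral_nonneg fun x => by positivity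
  have hA₁₈0 : 0 ≤ A₁₈ := by rw [hA₁₈]; exact integral_nonneg fun x => by positivity
  have hZ0 : 0 ≤ Z := by rw [hZ]; exact integral_nonneg fun x => by positivity
  -- the nine inputs
  have h1 : |X| ^ 2 ≤ 2 * A₈ * J := by
    rw [sq_abs, hX, ← hA₈', hJ]; exact stretching6_integral_sq_le hv
  have h2 : J ^ 2 ≤ A₄ * G := by
    rw [hJ, ← hA₄', hG]; exact weighted_gradPow_sq_le hv
  have h3 : G ≤ K * A₈ := by rw [hG, hA₈]; exact hK v hv hdiv
  have h4 : A₄ ^ 2 ≤ Z * A₆ := by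
    rw [hA₄, hZ, hA₆]; exact VelocityL6.integral_norm_pow_add_sq_le hωc 1 3
  have h5 : A₈ ^ 2 ≤ A₆ * A₁₀ := by
    rw [hA₈, hA₆, hA₁₀]; exact VelocityL6.integral_norm_pow_add_sq_le hωc 3 5
  have h6 : A₁₀ ^ 3 ≤ A₆ ^ 2 * A₁₈ := by
    rw [hA₁₀, hA₆, hA₁₈]; exact VelocityL6.integral_norm_pow_ten_pow_three_le hωc
  have h7 : A₆ ^ 2 ≤ Z * A₁₀ := by
    rw [hA₆, hZ, hA₁₀]; exact VelocityL6.integral_norm_pow_add_sq_le hωc 1 5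
  have h8 : A₁₀ ^ 2 ≤ Z * A₁₈ := by
    rw [hA₁₀, hZ, hA₁₈]; exact VelocityL6.integral_norm_pow_add_sq_le hωc 1 9
  have h9 : A₁₈ ≤ 32 * (729 * C₆ + (39420 * (3 : ℝ) ^ 3) ^ 3) * I ^ 3 := by
    have h := VelocityL6.integral_norm_pow_eighteen_le hC₆0 hC₆ hω h0
    simp only [Fintype.card_fin, Nat.cast_ofNat] at h
    rw [hA₁₈, hI]; exact h
  have key := production6_pow_24_le hA₄0 hA₆0 hA₁₀0 hA₁₈0 hZ0 h1 h2 h3 h4 h5 h6 h7 h8 h9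
  rw [hX, hA₆, hZ, hI] at key
  calc _ ≤ _ := key
    _ = _ := by ring

end VorticityL6

end Summit.NavierStokesRegularity.FunctionalMining
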